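import Literature.NumberTheory.QuadraticFields.FundamentalDiscriminant
import Literature.NumberTheory.QuadraticFields.DedekindZetaReducedForms
import Mathlib.Algebra.QuadraticAlgebra.Basic
import Mathlib.RingTheory.ClassGroup.Basic
import Mathlib.NumberTheory.NumberField.ClassNumber
import Mathlib.GroupTheory.PGroup
import Mathlib.GroupTheory.Perm.Cycle.Type
import HarnessLib

/-!
# The 3-torsion of the class group of a quadratic field as a function of the discriminant

Topic `NumberTheory/QuadraticFields`. For a fundamental discriminant `D` let `K_D` be "the"
quadratic field of discriminant `D` (it exists, `Quadratic.exists_numberField_discr_eq`, and is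
unique up to isomorphism, `Quadratic.nonempty_algEquiv_of_discr_eq` below). The arithmetic
statistics literature writes

* `Cl₃(D)` for the 3-torsion subgroup `Cl(K_D)[3] = {c ∈ Cl(𝓞_{K_D}) : c³ = 1}` and
  `#Cl₃(D) = h₃*(D)` for its order (Bhargava–Shankar–Tsimerman, Cor. 7 and §8.5: "let `Cl₃(D)`
  denote the 3-torsion subgroup of the ideal class group `Cl(D)` of `D`"; "`h₃*(K₂)` denotes the
  number of 3-torsion elements in the class group of `K₂`"; Davenport–Heilbronn 1971, Thm. 3),
* `r₃(D)` for the 3-rank, `#Cl₃(D) = 3^{r₃(D)}` (Cohen–Lenstra 1984, §9.I (C6): "the average of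
  `3^{r₃(K)}` is equal to 2", a theorem of Davenport–Heilbronn).

This file makes `D ↦ #Cl₃(D)` a total function `quadFieldThreeTorsion : ℤ → ℕ` (junk value `1`
off fundamental discriminants) — the statistic `t` of route QuantumAdvantage/ArithStatLadder,
whose items quantify over `t : ℤ → ℕ` under the hypothesis
`∀ D K, finrank ℚ K = 2 → discr K = D → t D = Nat.card {c : ClassGroup (𝓞 K) // c ^ 3 = 1}`;
`quadFieldThreeTorsion_eq` is exactly that hypothesis for `t := quadFieldThreeTorsion`.

## Main statements (all proved)

* `Quadratic.exists_not_mem_range_sq_eq_discr` — a quadratic field contains `δ ∉ ℚ` with `δ² = d_K`;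
* `Quadratic.nonempty_algEquiv_of_sq_eq`, `Quadratic.nonempty_algEquiv_of_discr_eq` — two
  quadratic fields with the same discriminant are `ℚ`-isomorphic (both are `ℚ(√d_K)`);
* `Quadratic.natCard_threeTorsion_eq_of_discr_eq` — hence their class groups have the same number
  of 3-torsion elements (`RingOfIntegers.mapRingEquiv`, `ClassGroup.mulEquiv`);
* `quadFieldThreeTorsion` and its characterisation `quadFieldThreeTorsion_eq` (i);
* `quadFieldThreeTorsion_of_not_isFundamental` (junk value), `quadFieldThreeTorsion_pos`;
* `three_dvd_classNumber_iff_one_lt_natCard` (Cauchy) and, for fundamental `D < 0`,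
  `three_dvd_classNumber_iff_one_lt_quadFieldThreeTorsion` :
  `3 ∣ h(D) ↔ 1 < #Cl₃(D)` with `h(D) = BinaryQuadraticForm.classNumber D` the form class number
  (bridge `Quadratic.card_reducedForms_eq_classNumber`, Cox Thm. 7.7) (ii);
* `exists_quadFieldThreeTorsion_eq_pow`, `quadFieldThreeRank`,
  `quadFieldThreeTorsion_eq_pow_quadFieldThreeRank` : `#Cl₃(D) = 3^{r₃(D)}` (iii).

Not here: the Davenport–Heilbronn mean values themselves (BST Cor. 7: mean `4/3` over real and
`2` over imaginary quadratic fields), the Hasse/Scholz dictionary with cubic fields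
(`#Cl₃(D) = 2·#{cubic fields of discriminant D} + 1`, BST §8.5), and the structure theorem
identifying `r₃` with the number of cyclic 3-primary factors of `Cl(K_D)`.

## References

* [BhargavaShankarTsimerman2012] M. Bhargava, A. Shankar, J. Tsimerman, *On the Davenport–Heilbronn
  theorems and second order terms*, Invent. Math. 193 (2013), Cor. 7 and §8.5 (arXiv:1005.0672).
* [DavenportHeilbronn1971] H. Davenport, H. Heilbronn, *On the density of discriminants of cubic
  fields. II*, Proc. Roy. Soc. London A 322 (1971), Thm. 3.
* [CohenLenstra1984] H. Cohen, H. W. Lenstra, *Heuristics on class groups of number fields*,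
  LNM 1068 (1984), §9.I (C6).
* [Cox2013] D. A. Cox, *Primes of the form x² + ny²*, 2nd ed., Thm. 7.7.
* [Marcus2018] D. A. Marcus, *Number Fields*, Ch. 2, Thm. 1 (quadratic fields are `ℚ(√m)`).
-/

noncomputable section

open Module NumberField

namespace Literature.NumberTheory.QuadraticFields

/-! ### Group-theoretic preliminaries: counting `n`-torsion elements -/

/-- The number of solutions of `cⁿ = 1` is invariant under group isomorphism. [folklore] -/
theorem natCard_pow_eq_one_congr {G H : Type*} [Monoid G] [Monoid H] (e : G ≃* H) (n : ℕ) :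
    Nat.card {c : G // c ^ n = 1} = Nat.card {c : H // c ^ n = 1} :=
  Nat.card_congr ((e : G ≃ H).subtypeEquiv fun c => by
    change c ^ n = 1 ↔ (e c) ^ n = 1
    rw [← map_pow, e.map_eq_one_iff])

/-- In a finite commutative group the solutions of `c³ = 1` form a 3-group (the kernel of
`c ↦ c³`), so their number is a power of `3`. [folklore] -/
theorem exists_natCard_pow_three_eq_one_eq_pow (G : Type*) [CommGroup G] [Finite G] :
    ∃ r : ℕ, Nat.card {c : G // c ^ 3 = 1} = 3 ^ r := by
  let S : Subgroup G := (powMonoidHom 3 : G →* G).ker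
  have hS : IsPGroup 3 S := by
    intro g
    refine ⟨1, Subtype.ext ?_⟩
    have hg := g.2
    rw [MonoidHom.mem_ker, powMonoidHom_apply] at hg
    rwa [pow_one, Subgroup.coe_pow, Subgroup.coe_one]
  obtain ⟨r, hr⟩ := hS.exists_card_eq
  refine ⟨r, ?_⟩
  rw [← hr]
  exact Nat.card_congr (Equiv.subtypeEquivRight fun c => by
    rw [MonoidHom.mem_ker, powMonoidHom_apply])

/-- **Cauchy at `3`.** A finite group has a nontrivial element with `c³ = 1` iff `3` divides its
order. [folklore] -/
theorem one_lt_natCard_pow_three_eq_one_iff (G : Type*) [Group G] [Finite G] :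
    1 < Nat.card {c : G // c ^ 3 = 1} ↔ 3 ∣ Nat.card G := by
  rw [Finite.one_lt_card_iff_nontrivial]
  constructor
  · rintro ⟨⟨c, hc⟩, ⟨d, hd⟩, hcd⟩
    -- one of `c`, `d` is `≠ 1` and has order `3`
    by_cases hc1 : c = 1
    · subst hc1
      have hd1 : d ≠ 1 := fun h => hcd (Subtype.ext h.symm)
      rw [← orderOf_eq_prime hd hd1]
      exact orderOf_dvd_natCard d
    · rw [← orderOf_eq_prime hc hc1]
      exact orderOf_dvd_natCard c
  · intro h3
    obtain ⟨c, hc⟩ := exists_prime_orderOf_dvd_card' 3 h3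
    refine ⟨⟨c, by rw [← hc]; exact pow_orderOf_eq_one c⟩, ⟨1, one_pow 3⟩, fun h => ?_⟩
    have h1 : c = 1 := congrArg Subtype.val h
    rw [h1, orderOf_one] at hc
    exact absurd hc (by norm_num)

/-- For a number field `K`: `3 ∣ h_K` iff `Cl(K)` has a nontrivial 3-torsion element, i.e.
`1 < #Cl(K)[3]`. [folklore] -/
theorem three_dvd_classNumber_iff_one_lt_natCard (K : Type*) [Field K] [NumberField K] :
    3 ∣ NumberField.classNumber K ↔ 1 < Nat.card {c : ClassGroup (𝓞 K) // c ^ 3 = 1} := by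
  rw [one_lt_natCard_pow_three_eq_one_iff, NumberField.classNumber, Nat.card_eq_fintype_card]

namespace Quadratic

/-! ### Quadratic fields with the same discriminant are isomorphic -/

section Field

variable {F : Type*} [Field F]

/-- If `θ ∉ F` and `θ² = c ∈ F` then `c` is not of the form `r²` (`+ 0·r`) with `r ∈ F`
(else `(θ - r)(θ + r) = 0` puts `θ` in `F`): the `Fact` under which Mathlib's model
`QuadraticAlgebra F c 0 = F[X]/(X² − c)` is a field. [folklore] -/
theorem fact_sq_ne_of_sq_eq {K : Type*} [Field K] [Algebra F K] {θ : K} {c : F}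
    (hθ : θ ∉ Set.range (algebraMap F K)) (hc : θ ^ 2 = algebraMap F K c) :
    Fact (∀ r : F, r ^ 2 ≠ c + 0 * r) := by
  refine ⟨fun r hr => ?_⟩
  rw [zero_mul, add_zero] at hr
  have h0 : θ ^ 2 - (algebraMap F K r) ^ 2 = 0 := by
    rw [hc, ← map_pow, hr, sub_self]
  rw [sq_sub_sq] at h0
  rcases mul_eq_zero.mp h0 with h | h
  · exact hθ ⟨-r, by rw [map_neg]; exact (eq_neg_of_add_eq_zero_left h).symm⟩
  · exact hθ ⟨r, (sub_eq_zero.mp h).symm⟩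

/-- A quadratic extension `K = F(θ)`, `θ² = c`, `θ ∉ F`, is `F`-isomorphic to the model
`QuadraticAlgebra F c 0` (the `F`-algebra map `ω ↦ θ` given by `QuadraticAlgebra.lift` is an
injective map between `2`-dimensional `F`-spaces). [folklore] -/
theorem nonempty_algEquiv_quadraticAlgebra {K : Type*} [Field K] [Algebra F K]
    (h2 : finrank F K = 2) {θ : K} {c : F}
    (hθ : θ ∉ Set.range (algebraMap F K)) (hc : θ ^ 2 = algebraMap F K c) :
    Nonempty (QuadraticAlgebra F c 0 ≃ₐ[F] K) := by
  haveI := fact_sq_ne_of_sq_eq hθ hc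
  haveI : FiniteDimensional F K := Module.finite_of_finrank_pos (by rw [h2]; exact two_pos)
  let f : QuadraticAlgebra F c 0 →ₐ[F] K :=
    QuadraticAlgebra.lift ⟨θ, by rw [zero_smul, add_zero, ← sq, hc, Algebra.algebraMap_eq_smul_one]⟩
  have hinj : Function.Injective f := f.toRingHom.injective
  have hdim : finrank F (QuadraticAlgebra F c 0) = finrank F K := by
    rw [QuadraticAlgebra.finrank_eq_two, h2]
  have hsurj : Function.Surjective f :=
    (LinearMap.injective_iff_surjective_of_finrank_eq_finrank hdim (f := f.toLinearMap)).mp hinj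
  exact ⟨AlgEquiv.ofBijective f ⟨hinj, hsurj⟩⟩

/-- **Quadratic extensions generated by square roots of the same element are isomorphic**:
if `[K : F] = [K' : F] = 2`, `K ∋ θ ∉ F`, `K' ∋ θ' ∉ F` and `θ² = θ'² = c ∈ F`, then
`K ≃ₐ[F] K'` (both are `F(√c)`). [folklore] -/
theorem nonempty_algEquiv_of_sq_eq {K K' : Type*} [Field K] [Algebra F K] [Field K']
    [Algebra F K'] (h2 : finrank F K = 2) (h2' : finrank F K' = 2) {θ : K} {θ' : K'} {c : F}
    (hθ : θ ∉ Set.range (algebraMap F K)) (hc : θ ^ 2 = algebraMap F K c)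
    (hθ' : θ' ∉ Set.range (algebraMap F K')) (hc' : θ' ^ 2 = algebraMap F K' c) :
    Nonempty (K ≃ₐ[F] K') := by
  obtain ⟨e⟩ := nonempty_algEquiv_quadraticAlgebra h2 hθ hc
  obtain ⟨e'⟩ := nonempty_algEquiv_quadraticAlgebra h2' hθ' hc'
  exact ⟨e.symm.trans e'⟩

end Field

section NumberField

variable {K : Type*} [Field K] [NumberField K]

/-- **A quadratic field is `ℚ(√d_K)`**: if `[K : ℚ] = 2` there is `δ ∈ K`, `δ ∉ ℚ`, with
`δ² = d_K` — from a square-root generator `θ² = c` (`exists_sq_eq_algebraMap`) and `d_K = c q²`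
(`NumberField.exists_discr_eq_mul_sq`), `δ = qθ`. Marcus, *Number Fields*, Ch. 2, Thm. 1.
(Universe-polymorphic form of `Literature.NumberTheory.EllipticCurves.exists_sq_eq_discr_not_mem_range`,
which is stated for `K : Type` in a file with heavy imports.) [folklore] -/
theorem exists_not_mem_range_sq_eq_discr (h2 : finrank ℚ K = 2) :
    ∃ δ : K, δ ∉ Set.range (algebraMap ℚ K) ∧ δ ^ 2 = algebraMap ℚ K (NumberField.discr K : ℚ) := by
  obtain ⟨θ, c, hθ, hc⟩ := exists_sq_eq_algebraMap (F := ℚ) (K := K) h2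
  obtain ⟨q, hq, hD⟩ := NumberField.exists_discr_eq_mul_sq h2 hθ hc
  refine ⟨algebraMap ℚ K q * θ, ?_, ?_⟩
  · rintro ⟨r, hr⟩
    refine hθ ⟨r / q, ?_⟩
    rw [map_div₀, hr, mul_div_cancel_left₀ _ ((map_ne_zero (algebraMap ℚ K)).mpr hq)]
  · rw [mul_pow, hc, ← map_pow, ← map_mul, hD, mul_comm]

/-- **Uniqueness of the quadratic field with given discriminant**: two quadratic number fields
with the same discriminant are isomorphic (both are `ℚ(√d_K)`, `exists_not_mem_range_sq_eq_discr`). With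
`isFundamentalDiscriminant_discr` and `exists_numberField_discr_eq`
(`FundamentalDiscriminant.lean`) this is the bijection "quadratic fields/≅ ↔ fundamental
discriminants". Marcus, *Number Fields*, Ch. 2, Thm. 1; Cox, §5.B. [folklore] -/
theorem nonempty_algEquiv_of_discr_eq {K' : Type*} [Field K'] [NumberField K']
    (h2 : finrank ℚ K = 2) (h2' : finrank ℚ K' = 2)
    (h : NumberField.discr K = NumberField.discr K') : Nonempty (K ≃ₐ[ℚ] K') := by
  obtain ⟨δ, hδ, hδ2⟩ := exists_not_mem_range_sq_eq_discr h2
  obtain ⟨δ', hδ', hδ2'⟩ := exists_not_mem_range_sq_eq_discr h2'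
  rw [h] at hδ2
  exact nonempty_algEquiv_of_sq_eq h2 h2' hδ hδ2 hδ' hδ2'

/-- Quadratic fields with the same discriminant have the same number of 3-torsion ideal classes
(transport `Cl(𝓞 K) ≃* Cl(𝓞 K')` along `K ≃ K'`: `RingOfIntegers.mapRingEquiv`,
`ClassGroup.mulEquiv`). [folklore] -/
theorem natCard_threeTorsion_eq_of_discr_eq {K' : Type*} [Field K'] [NumberField K']
    (h2 : finrank ℚ K = 2) (h2' : finrank ℚ K' = 2)
    (h : NumberField.discr K = NumberField.discr K') :
    Nat.card {c : ClassGroup (𝓞 K) // c ^ 3 = 1} =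
      Nat.card {c : ClassGroup (𝓞 K') // c ^ 3 = 1} := by
  obtain ⟨e⟩ := nonempty_algEquiv_of_discr_eq h2 h2' h
  exact natCard_pow_eq_one_congr
    (ClassGroup.mulEquiv (RingOfIntegers.mapRingEquiv e.toRingEquiv)) 3

/-- A fundamental discriminant is exactly the discriminant of a quadratic field (combining
`isFundamentalDiscriminant_discr` and `exists_numberField_discr_eq` of
`FundamentalDiscriminant.lean`; the quadratic field may be taken in `Type`). [folklore] -/
theorem isFundamental_iff_exists_discr_eq (D : ℤ) :
    ((D % 4 = 1 ∧ Squarefree D ∧ D ≠ 1) ∨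
      (4 ∣ D ∧ (D / 4 % 4 = 2 ∨ D / 4 % 4 = 3) ∧ Squarefree (D / 4))) ↔
    ∃ (K : Type) (_ : Field K) (_ : NumberField K),
      Module.finrank ℚ K = 2 ∧ NumberField.discr K = D := by
  refine ⟨exists_numberField_discr_eq, ?_⟩
  rintro ⟨K, _, _, h2, rfl⟩
  exact isFundamentalDiscriminant_discr h2

end NumberField

end Quadratic

/-! ### `#Cl₃(D)` as a function of the discriminant -/

open Quadratic

/-- **`#Cl₃(D) = h₃*(D)`, the number of 3-torsion ideal classes of the quadratic field of
discriminant `D`**, as a total function of `D : ℤ`: if `D = d_K` for a quadratic number field `K`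
(equivalently, `D` is a fundamental discriminant, `Quadratic.isFundamental_iff_exists_discr_eq`)
then `quadFieldThreeTorsion D = Nat.card {c : ClassGroup (𝓞 K) // c ^ 3 = 1} = #Cl(K)[3]`
— independent of the choice of `K` (`quadFieldThreeTorsion_eq`,
`Quadratic.natCard_threeTorsion_eq_of_discr_eq`); otherwise the junk value `1`
(`quadFieldThreeTorsion_of_not_isFundamental`). Bhargava–Shankar–Tsimerman, Cor. 7: "let
`Cl₃(D)` denote the 3-torsion subgroup of the ideal class group `Cl(D)` of `D`", averaged there
(after Davenport–Heilbronn 1971, Thm. 3) to `4/3` over `0 < D < X` and `2` over `−X < D < 0`;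
`h₃*(K₂)` in BST §8.5; `3^{r₃(K)}` in Cohen–Lenstra §9.I (C6).
[cite: BhargavaShankarTsimerman2012, Cor. 7] -/
def quadFieldThreeTorsion (D : ℤ) : ℕ := by
  classical
  exact if h : ∃ (K : Type) (_ : Field K) (_ : NumberField K),
      Module.finrank ℚ K = 2 ∧ NumberField.discr K = D then
    letI : Field h.choose := h.choose_spec.choose
    Nat.card {c : ClassGroup (𝓞 h.choose) // c ^ 3 = 1}
  else 1

/-- **Characterisation (i).** For EVERY quadratic number field `K` of discriminant `D`,
`quadFieldThreeTorsion D = #Cl(K)[3]` — literally the hypothesis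
`∀ D K, finrank ℚ K = 2 → discr K = D → t D = Nat.card {c : ClassGroup (𝓞 K) // c ^ 3 = 1}`
of route ArithStatLadder's `DigitRung` / `AcZeroRung` / `EndJuntaRung` for
`t := quadFieldThreeTorsion` (any universe for `K`). [folklore] -/
theorem quadFieldThreeTorsion_eq (D : ℤ) (K : Type*) [Field K] [NumberField K]
    (h2 : Module.finrank ℚ K = 2) (hD : NumberField.discr K = D) :
    quadFieldThreeTorsion D = Nat.card {c : ClassGroup (𝓞 K) // c ^ 3 = 1} := by
  classical
  have h : ∃ (K : Type) (_ : Field K) (_ : NumberField K),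
      Module.finrank ℚ K = 2 ∧ NumberField.discr K = D :=
    exists_numberField_discr_eq (hD ▸ isFundamentalDiscriminant_discr h2)
  rw [quadFieldThreeTorsion, dif_pos h]
  letI : Field h.choose := h.choose_spec.choose
  letI : NumberField h.choose := h.choose_spec.choose_spec.choose
  obtain ⟨h2₀, hD₀⟩ := h.choose_spec.choose_spec.choose_spec
  exact natCard_threeTorsion_eq_of_discr_eq h2₀ h2 (hD₀.trans hD.symm)

/-- The hypothesis `IST3 t` of route ArithStatLadder, discharged by `t := quadFieldThreeTorsion`
(restating `quadFieldThreeTorsion_eq` in the route's binder shape, `K : Type`). [folklore] -/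
theorem quadFieldThreeTorsion_spec :
    ∀ (D : ℤ) (K : Type) [Field K] [NumberField K], Module.finrank ℚ K = 2 →
      NumberField.discr K = D →
        quadFieldThreeTorsion D = Nat.card {c : ClassGroup (𝓞 K) // c ^ 3 = 1} :=
  fun D K _ _ h2 hD => quadFieldThreeTorsion_eq D K h2 hD

/-- Junk value: off fundamental discriminants (no quadratic field has discriminant `D`)
`quadFieldThreeTorsion D = 1`. [folklore] -/
theorem quadFieldThreeTorsion_of_not_isFundamental {D : ℤ}
    (hD : ¬ ((D % 4 = 1 ∧ Squarefree D ∧ D ≠ 1) ∨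
      (4 ∣ D ∧ (D / 4 % 4 = 2 ∨ D / 4 % 4 = 3) ∧ Squarefree (D / 4)))) :
    quadFieldThreeTorsion D = 1 := by
  classical
  rw [isFundamental_iff_exists_discr_eq] at hD
  rw [quadFieldThreeTorsion, dif_neg hD]

/-- `quadFieldThreeTorsion D ≥ 1` always (the trivial class is 3-torsion; `Cl(K)` is finite).
[folklore] -/
theorem quadFieldThreeTorsion_pos (D : ℤ) : 0 < quadFieldThreeTorsion D := by
  classical
  by_cases hD : (D % 4 = 1 ∧ Squarefree D ∧ D ≠ 1) ∨
      (4 ∣ D ∧ (D / 4 % 4 = 2 ∨ D / 4 % 4 = 3) ∧ Squarefree (D / 4))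
  · obtain ⟨K, _, _, h2, hdisc⟩ := exists_numberField_discr_eq hD
    rw [quadFieldThreeTorsion_eq D K h2 hdisc]
    haveI : Nonempty {c : ClassGroup (𝓞 K) // c ^ 3 = 1} := ⟨⟨1, one_pow 3⟩⟩
    exact Nat.card_pos
  · rw [quadFieldThreeTorsion_of_not_isFundamental hD]
    exact one_pos

/-- **(ii) `3 ∣ h(D) ↔ 1 < #Cl₃(D)`** for a fundamental discriminant `D < 0`, where
`h(D) = BinaryQuadraticForm.classNumber D` is the form class number (number of reduced primitive
positive definite forms of discriminant `D`), equal to `h_K` for the imaginary quadratic field `K`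
of discriminant `D` by the PROVED `Quadratic.card_reducedForms_eq_classNumber` (Cox, Thm. 7.7);
then Cauchy's theorem in the finite group `Cl(𝓞 K)`. This links the language
`IQ3 = {d : −d fundamental, 3 ∣ h(−d)}` of route ArithStatLadder to its statistic
`t = quadFieldThreeTorsion`. [folklore] -/
theorem three_dvd_classNumber_iff_one_lt_quadFieldThreeTorsion {D : ℤ}
    (hD : (D % 4 = 1 ∧ Squarefree D ∧ D ≠ 1) ∨
      (4 ∣ D ∧ (D / 4 % 4 = 2 ∨ D / 4 % 4 = 3) ∧ Squarefree (D / 4)))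
    (hD0 : D < 0) :
    3 ∣ BinaryQuadraticForm.classNumber D ↔ 1 < quadFieldThreeTorsion D := by
  obtain ⟨K, _, _, h2, hdisc⟩ := exists_numberField_discr_eq hD
  rw [quadFieldThreeTorsion_eq D K h2 hdisc, ← hdisc,
    card_reducedForms_eq_classNumber h2 (hdisc.symm ▸ hD0)]
  exact three_dvd_classNumber_iff_one_lt_natCard K

/-- **(iii) `#Cl₃(D)` is a power of `3`** (`Cl(K)[3]` is an elementary abelian 3-group; off
fundamental discriminants the value is `1 = 3⁰`). [folklore] -/
theorem exists_quadFieldThreeTorsion_eq_pow (D : ℤ) : ∃ r : ℕ, quadFieldThreeTorsion D = 3 ^ r := by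
  by_cases hD : (D % 4 = 1 ∧ Squarefree D ∧ D ≠ 1) ∨
      (4 ∣ D ∧ (D / 4 % 4 = 2 ∨ D / 4 % 4 = 3) ∧ Squarefree (D / 4))
  · obtain ⟨K, _, _, h2, hdisc⟩ := exists_numberField_discr_eq hD
    rw [quadFieldThreeTorsion_eq D K h2 hdisc]
    exact exists_natCard_pow_three_eq_one_eq_pow _
  · exact ⟨0, by rw [quadFieldThreeTorsion_of_not_isFundamental hD, pow_zero]⟩

/-- **The 3-rank `r₃(D)`** of the class group of the quadratic field of discriminant `D`, defined
here as `log₃ #Cl₃(D)` (so that `#Cl₃(D) = 3^{r₃(D)}`, `quadFieldThreeTorsion_eq_pow_quadFieldThreeRank`);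
since `Cl(K)[3]` is an elementary abelian 3-group this is `dim_{𝔽₃} Cl(K)[3]`, the number of
cyclic factors of 3-power order of `Cl(K)` — Cohen–Lenstra's `r₃(K)` ("the average of `3^{r₃(K)}`
is equal to 2", §9.I (C6)). Junk value `0` off fundamental discriminants.
[cite: CohenLenstra1984, §9.I (C6)] -/
def quadFieldThreeRank (D : ℤ) : ℕ := Nat.log 3 (quadFieldThreeTorsion D)

/-- `#Cl₃(D) = 3^{r₃(D)}`. [folklore] -/
theorem quadFieldThreeTorsion_eq_pow_quadFieldThreeRank (D : ℤ) :
    quadFieldThreeTorsion D = 3 ^ quadFieldThreeRank D := by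
  obtain ⟨r, hr⟩ := exists_quadFieldThreeTorsion_eq_pow D
  rw [quadFieldThreeRank, hr, Nat.log_pow (by norm_num : 1 < 3)]

/-- `3 ∣ h(D) ↔ 0 < r₃(D)` for fundamental `D < 0` ((ii) in terms of the 3-rank). [folklore] -/
theorem three_dvd_classNumber_iff_quadFieldThreeRank_pos {D : ℤ}
    (hD : (D % 4 = 1 ∧ Squarefree D ∧ D ≠ 1) ∨
      (4 ∣ D ∧ (D / 4 % 4 = 2 ∨ D / 4 % 4 = 3) ∧ Squarefree (D / 4)))
    (hD0 : D < 0) :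
    3 ∣ BinaryQuadraticForm.classNumber D ↔ 0 < quadFieldThreeRank D := by
  rw [three_dvd_classNumber_iff_one_lt_quadFieldThreeTorsion hD hD0,
    quadFieldThreeTorsion_eq_pow_quadFieldThreeRank]
  constructor
  · intro h
    by_contra h0
    rw [Nat.pos_iff_ne_zero, not_not] at h0
    rw [h0, pow_zero] at h
    exact lt_irrefl 1 h
  · intro h
    calc 1 < 3 ^ 1 := by norm_num
      _ ≤ 3 ^ quadFieldThreeRank D := Nat.pow_le_pow_right (by norm_num) h

end Literature.NumberTheory.QuadraticFields

end
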